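import Literature.Analysis.DeBrangesSpaces.BurnolSonineEvaluatorCombinationEntire
import Literature.Analysis.DeBrangesSpaces.BurnolCosineKernelSingularExpansion
import Literature.Analysis.DeBrangesSpaces.BurnolXPairingFourierSwap
import Literature.Analysis.DeBrangesSpaces.BurnolDominantSingularities
import HarnessLib

/-!
# Burnol 2001 (CRAS 333), Théorème 1.5: the projections of the vectors `X^λ_{w,k}` on `K_{λ,λ}`
# are linearly independent — proof

LABEL (line 1): **RH-FREE** — Fourier analysis of the Sonine spaces `K_{λ,λ}`; `ζ` does not occur.
bears_on: LADDER-RH COLUMN 6 (DBR), B-C/B-P, as corpus vocabulary only. WHAT THIS IS NOT: not a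
route, not a criterion; linear independence of Burnol's evaluators does not move RH; nothing here
bears on the truth of RH.

This file DISCHARGES the named fact `Burnol2001CRAS_thm1_5C` of `BurnolSonineSpaces.lean`
(J.-F. Burnol, *Sur certains espaces de Hilbert de fonctions entières, liés à la transformation de
Fourier et aux fonctions L de Dirichlet et de Riemann*, C. R. Acad. Sci. Paris Sér. I **333** (2001)
201–206 = arXiv:math/0105120, Théorème 1.5, TeX of record `dbl/src/Burnol2001CRAS_arXivmath0105120.tex`
l.406–420): *Soit `λ > 0`. Les projections orthogonales des vecteurs `X^λ_{w,k}` sur `K_{λ,λ}` sont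
linéairement indépendantes* — in the tree's (faithful, referee-countersigned) rendering: the
functionals `f ↦ (f, X^λ_{w,k}]` (`= (d/dw)^k f̂(1−w)` for `Re w > 1/2`, `= (d/dw)^k(γ₊(w)f̂(1−w))`
compensated for `Re w ≤ 1/2`) restricted to `K_{λ,λ}` are linearly independent.

## Burnol's proof (TeX l.409–420) and how it is followed

"Supposons qu'une combinaison linéaire finie des `X^λ_{w,k}` soit dans `K^⊥_{λ,λ}` … la combinaison
linéaire correspondante des `D_{w,k}(t)` (qui est analytique en `t` sur `]0,∞[`) doit être dans
`𝓕₊(L²(]0,λ]))`" — `exists_entire_eq_sum_of_pairings_eq_zero` (`BurnolSonineEvaluatorCombinationEntire`):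
`Σ c_{w,k} D_{w,k}(t) = E(t)` on `(0,∞)` with `E` entire.  "Elle ne peut être de carré intégrable au
voisinage de l'origine que si il n'y a aucune contribution d'un couple `(k,w)` avec `Re(w) > 1/2` car
alors `D_{w,k}(t) = (log(1/t))^k t^{−w}`.  On élimine pour la même raison les couples `(w,k)` vérifiant
`Re(w) = 1/2` car alors `D_{w,k}(t)` a par le Lemme (1.3) une singularité dominante pour `t → 0` du
type `(log(1/t))^k t^{−w}`" — we use the stronger form available from the tree's singular expansion
(`exists_singular_expansion_iteratedDeriv_cosKernel`: dominant term `γ₊(w)(log 1/t)^k t^{−w}` for every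
`Re w > 0`, `γ₊(w) ≠ 0` for `0 < Re w ≤ 1/2`) and the elimination lemma
`eq_zero_of_sum_log_pow_mul_cpow_eq` (`BurnolDominantSingularities`): continuity of `E` at `0` kills
the coefficient of every index `(w,k)` with `Re w > 0` and `k` maximal (`exists_coeff_eq_zero_of_pos`).
"On remarque finalement pour `Re(w) < 1/2` par l'équation (1.1) l'identité
`(𝓕₊(f), X^λ_{w,k}] = (d^k/d^kw)(f̂(w))` qui montre que `𝓕₊(X^λ_{w,k})` et `(−1)^k X_{1−w,k}` ont la
même projection sur `K_{λ,λ}`.  On est donc ramené au cas précédemment éliminé" —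
`xPairingR_fourier_swap` (`BurnolXPairingFourierSwap`): when all indices have `Re w ≤ 0` the
hypothesis transfers to the indices `(1−w, k)`, all with `Re ≥ 1` (`pairings_eq_zero_swap`).  An
induction on the number of indices concludes (`Burnol2001CRAS_thm1_5C_holds`).

No definitions, no new named facts (D-0026).

## References
* [Burnol2001CRAS] J.-F. Burnol, C. R. Acad. Sci. Paris Sér. I 333 (2001) 201–206 = arXiv:math/0105120,
  Théorème 1.5 and its proof (TeX l.393–420), Lemme 1.3 (TeX l.358–364).
-/

noncomputable section

open _root_.MeasureTheory _root_.Complex _root_.Set _root_.Filter _root_.Metric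
open scoped Real Topology FourierTransform ComplexConjugate

open Literature.NumberTheory.ConnesConsani2021 (soninSpace)
open Literature.Analysis.DeBrangesSpaces.SonineMellin (cosKernel)

namespace Literature.Analysis.DeBrangesSpaces

namespace Burnol2001

/-! ## A. The expansions of the functions `D_{w,k}` at `0⁺` -/

/-- `γ₊(w) ≠ 0` for `0 < Re w ≤ 1/2` (the zeros of `γ₊` with `Re w > 0` are `1, 3, 5, …`).
[cite: Burnol2001CRAS, §1 (TeX l.361)] -/
private theorem gammaPlus_ne_zero_of_re_le_half {w : ℂ} (hw : 0 < w.re) (hw' : w.re ≤ 1 / 2) :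
    gammaPlus w ≠ 0 := by
  intro h
  obtain ⟨j, hj⟩ := exists_eq_one_add_two_mul_of_gammaPlus_eq_zero hw h
  have := congrArg Complex.re hj
  simp at this
  have : (0 : ℝ) ≤ j := Nat.cast_nonneg j
  linarith

/-- **Unified expansion of `D_{w,k}(t)` at `t → 0⁺`**: for every `(w,k)` there are coefficients
`coef 0, …, coef k` (zero beyond `k`, all zero when `Re w ≤ 0`) and a remainder `R` with
`t^θ‖R(t)‖ → 0` for every `θ > 0`, such that `D_{w,k}(t) = Σ_{j≤k} coef_j (log t)^j t^{−w} + R(t)` on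
`(0,∞)`, and the top coefficient `coef_k` is NON-ZERO whenever `Re w > 0` (`= (−1)^k` for
`Re w > 1/2`, `= (−1)^k γ₊(w)` for `0 < Re w ≤ 1/2`): "une singularité dominante pour `t → 0` du type
`(log(1/t))^k t^{−w}`". [cite: Burnol2001CRAS, Lemme 1.3 and proof of Théorème 1.5 (TeX l.358–364, 412–416)] -/
theorem exists_expansion_D {lam : ℝ} (hlam : 0 < lam) (p : ℂ × ℕ) :
    ∃ coef : ℕ → ℂ, ∃ R : ℝ → ℂ,
      (∀ θ : ℝ, 0 < θ → Tendsto (fun t : ℝ ↦ t ^ θ * ‖R t‖) (𝓝[>] (0 : ℝ)) (𝓝 0)) ∧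
      (∀ t : ℝ, 0 < t →
        (if 1 / 2 < p.1.re then (-(Real.log t : ℂ)) ^ p.2 * (t : ℂ) ^ (-p.1)
          else iteratedDeriv p.2 (cosKernel lam t) p.1) =
        ∑ j ∈ Finset.range (p.2 + 1), coef j * ((Real.log t : ℝ) : ℂ) ^ j * ((t : ℝ) : ℂ) ^ (-p.1) +
          R t) ∧
      (∀ j : ℕ, p.2 < j → coef j = 0) ∧ (p.1.re ≤ 0 → ∀ j : ℕ, coef j = 0) ∧
      (0 < p.1.re → coef p.2 ≠ 0) := by
  obtain ⟨w, k⟩ := p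
  dsimp only
  by_cases hA : 1 / 2 < w.re
  · -- `Re w > 1/2`: `D(t) = (−log t)^k t^{−w}` exactly
    refine ⟨fun j ↦ if j = k then (-1) ^ k else 0, fun _ ↦ 0, fun θ hθ ↦ ?_, fun t ht ↦ ?_,
      fun j hj ↦ ?_, fun hw ↦ ?_, fun _ ↦ ?_⟩
    · simp only [norm_zero, mul_zero]; exact tendsto_const_nhds
    · rw [if_pos hA, add_zero, Finset.sum_eq_single k]
      · beta_reduce; rw [if_pos rfl, neg_pow]
      · intro j _ hj; beta_reduce; rw [if_neg hj, zero_mul, zero_mul]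
      · intro h; exact absurd (Finset.self_mem_range_succ k) h
    · beta_reduce; exact if_neg (ne_of_gt hj)
    · exfalso; linarith
    · beta_reduce; rw [if_pos rfl]; exact pow_ne_zero _ (by norm_num)
  · by_cases hB : 0 < w.re
    · -- `0 < Re w ≤ 1/2`: the singular expansion of `∂_w^k C_λ(t,w)`
      obtain ⟨γt, hγ0, R, hR, hexp⟩ := exists_singular_expansion_iteratedDeriv_cosKernel hlam k hB
      refine ⟨fun j ↦ (k.choose j : ℂ) * (-1) ^ j * γt (k - j), R, hR, fun t ht ↦ ?_,
        fun j hj ↦ ?_, fun hw ↦ ?_, fun _ ↦ ?_⟩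
      · rw [if_neg hA, hexp t ht]
      · simp [Nat.choose_eq_zero_of_lt hj]
      · exfalso; linarith
      · simp only [Nat.choose_self, Nat.cast_one, one_mul, Nat.sub_self, hγ0]
        exact mul_ne_zero (pow_ne_zero _ (by norm_num))
          (gammaPlus_ne_zero_of_re_le_half hB (not_lt.1 hA))
    · -- `Re w ≤ 0`: everything goes into the remainder
      have hw0 : w.re ≤ 0 := not_lt.1 hB
      refine ⟨fun _ ↦ 0, fun t ↦ iteratedDeriv k (cosKernel lam t) w,
        fun θ hθ ↦ tendsto_rpow_mul_norm_iteratedDeriv_cosKernel hlam k hw0 hθ, fun t ht ↦ ?_,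
        fun j _ ↦ rfl, fun _ _ ↦ rfl, fun hw ↦ ?_⟩
      · rw [if_neg hA]; simp
      · exfalso; linarith

/-! ## B. Elimination: an index with `Re w > 0` and `k` maximal has coefficient zero -/

/-- **The elimination step** (TeX l.412–416): if `Σ_{(w,k)∈s} c_{w,k}(f, X^λ_{w,k}] = 0` for every
`f ∈ K_{λ,λ}` and some index has `Re w > 0`, then some coefficient vanishes — namely that of an index
`(w*, k*)` with `Re w* > 0` and `k*` maximal among the indices with first coordinate `w*`: the
combination `Σ c D` is entire on `(0,∞)`, in particular bounded at `0⁺`, and the dominant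
singularities `(log 1/t)^k t^{−w}` are eliminated layer by layer (`eq_zero_of_sum_log_pow_mul_cpow_eq`).
[cite: Burnol2001CRAS, Théorème 1.5, proof (TeX l.409–416)] -/
theorem exists_coeff_eq_zero_of_pos {lam : ℝ} (hlam : 0 < lam) (s : Finset (ℂ × ℕ))
    (c : ℂ × ℕ → ℂ)
    (hc : ∀ f : Lp ℂ 2 (volume : Measure ℝ), f ∈ soninSpace lam lam → ∀ G P : ℂ → ℂ,
      HasEntireMellin f G → IsXPairingFnC G P → ∑ p ∈ s, c p * xPairingR G P p.1 p.2 = 0)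
    (hex : ∃ p ∈ s, 0 < p.1.re) : ∃ p ∈ s, c p = 0 := by
  classical
  -- the functions `D_p` and the entire function `E`
  set D : ℂ × ℕ → ℝ → ℂ := fun p t ↦ if 1 / 2 < p.1.re then (-(Real.log t : ℂ)) ^ p.2 * (t : ℂ) ^ (-p.1)
    else iteratedDeriv p.2 (cosKernel lam t) p.1 with hD
  obtain ⟨E, hE, hVE⟩ := exists_entire_eq_sum_of_pairings_eq_zero hlam s c hc
  have hVE' : ∀ t : ℝ, 0 < t → ∑ p ∈ s, c p * D p t = E t := hVE
  -- the expansions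
  have hexpand := fun p : ℂ × ℕ ↦ exists_expansion_D hlam p
  choose coef R hR hDexp hcoef_gt hcoef_nonpos hcoef_top using hexpand
  -- the distinguished index: `Re w* > 0`, `k*` maximal in its fibre
  obtain ⟨p₁, hp₁, hp₁re⟩ := hex
  set T : Finset (ℂ × ℕ) := s.filter (fun p ↦ p.1 = p₁.1) with hT
  have hTne : T.Nonempty := ⟨p₁, Finset.mem_filter.2 ⟨hp₁, rfl⟩⟩
  obtain ⟨pstar, hpstarT, hmax⟩ := Finset.exists_max_image T Prod.snd hTne
  have hpstar : pstar ∈ s := (Finset.mem_filter.1 hpstarT).1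
  have hpstar1 : pstar.1 = p₁.1 := (Finset.mem_filter.1 hpstarT).2
  have hpstar_re : 0 < pstar.1.re := by rw [hpstar1]; exact hp₁re
  have hmax' : ∀ p ∈ s, p.1 = pstar.1 → p.2 ≤ pstar.2 := fun p hp hp1 ↦
    hmax p (Finset.mem_filter.2 ⟨hp, hp1.trans hpstar1⟩)
  refine ⟨pstar, hpstar, ?_⟩
  -- the re-expanded index set and coefficients
  set sp : Finset (ℂ × ℕ) := s.filter (fun p ↦ 0 < p.1.re) with hsp
  set W : Finset ℂ := sp.image Prod.fst with hW
  set K : ℕ := s.sup Prod.snd with hK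
  set S' : Finset (ℂ × ℕ) := W ×ˢ Finset.range (K + 1) with hS'
  set cbar : ℂ × ℕ → ℂ := fun p ↦ if p ∈ s then c p else 0 with hcbar
  set c' : ℂ × ℕ → ℂ := fun q ↦ ∑ i ∈ Finset.range (K + 1), cbar (q.1, i) * coef (q.1, i) q.2 with hc'
  set E' : ℝ → ℂ := fun t ↦ E t - ∑ p ∈ s, c p * R p t with hE'
  have hsp_sub : sp ⊆ S' := by
    intro p hp
    have hps : p ∈ s := (Finset.mem_filter.1 hp).1
    refine Finset.mem_product.2 ⟨Finset.mem_image.2 ⟨p, hp, rfl⟩, Finset.mem_range.2 ?_⟩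
    exact Nat.lt_succ_of_le (Finset.le_sup (f := Prod.snd) hps)
  have hS'pos : ∀ q ∈ S', 0 < q.1.re := by
    intro q hq
    obtain ⟨hq1, -⟩ := Finset.mem_product.1 hq
    obtain ⟨p, hp, hpq⟩ := Finset.mem_image.1 hq1
    rw [← hpq]
    exact (Finset.mem_filter.1 hp).2
  -- (1) the algebraic identity `Σ_{q∈S'} c'_q (log t)^{j} t^{−w} = E'(t)` on `(0,∞)`
  have hident : ∀ t : ℝ, 0 < t → ∑ q ∈ S', c' q * ((Real.log t : ℝ) : ℂ) ^ q.2 * ((t : ℝ) : ℂ) ^ (-q.1)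
      = E' t := by
    intro t ht
    -- monomials
    set m : ℂ × ℕ → ℂ := fun q ↦ ((Real.log t : ℝ) : ℂ) ^ q.2 * ((t : ℝ) : ℂ) ^ (-q.1) with hm
    -- truncated expansions `T' p = Σ_{j ≤ k} coef p j (log t)^j t^{−w} = D p t − R p t`
    have hT' : ∀ p : ℂ × ℕ, ∑ j ∈ Finset.range (p.2 + 1), coef p j * m (p.1, j) = D p t - R p t := by
      intro p
      rw [eq_sub_iff_add_eq, hD]; dsimp only
      rw [hDexp p t ht]
      simp only [hm, mul_assoc]
    -- step 1: unfold `c'` and exchange the sums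
    have h1 : ∑ q ∈ S', c' q * ((Real.log t : ℝ) : ℂ) ^ q.2 * ((t : ℝ) : ℂ) ^ (-q.1) =
        ∑ p ∈ S', cbar p * ∑ j ∈ Finset.range (K + 1), coef p j * m (p.1, j) := by
      calc ∑ q ∈ S', c' q * ((Real.log t : ℝ) : ℂ) ^ q.2 * ((t : ℝ) : ℂ) ^ (-q.1)
          = ∑ q ∈ S', ∑ i ∈ Finset.range (K + 1), cbar (q.1, i) * coef (q.1, i) q.2 * m q := by
            refine Finset.sum_congr rfl fun q _ ↦ ?_
            rw [hc', hm]; dsimp only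
            rw [mul_assoc, Finset.sum_mul]
        _ = ∑ w ∈ W, ∑ j ∈ Finset.range (K + 1), ∑ i ∈ Finset.range (K + 1),
              cbar (w, i) * coef (w, i) j * m (w, j) := by rw [hS', Finset.sum_product]
        _ = ∑ w ∈ W, ∑ i ∈ Finset.range (K + 1), ∑ j ∈ Finset.range (K + 1),
              cbar (w, i) * coef (w, i) j * m (w, j) :=
            Finset.sum_congr rfl fun w _ ↦ Finset.sum_comm
        _ = ∑ p ∈ S', ∑ j ∈ Finset.range (K + 1), cbar p * coef p j * m (p.1, j) := by
            rw [hS', Finset.sum_product]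
        _ = ∑ p ∈ S', cbar p * ∑ j ∈ Finset.range (K + 1), coef p j * m (p.1, j) := by
            refine Finset.sum_congr rfl fun p _ ↦ ?_
            rw [Finset.mul_sum]
            exact Finset.sum_congr rfl fun j _ ↦ by ring
    -- step 2: truncate the inner sums at `p.2` (coefficients vanish beyond)
    have h2 : ∀ p ∈ S', ∑ j ∈ Finset.range (K + 1), coef p j * m (p.1, j) =
        ∑ j ∈ Finset.range (p.2 + 1), coef p j * m (p.1, j) := by
      intro p hp
      have hpK : p.2 + 1 ≤ K + 1 := Finset.mem_range.1 (Finset.mem_product.1 hp).2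
      symm
      refine Finset.sum_subset (Finset.range_subset_range.2 hpK) fun j hj hj' ↦ ?_
      have : p.2 < j := by
        rw [Finset.mem_range, not_lt] at hj'
        omega
      rw [hcoef_gt p j this, zero_mul]
    -- step 3: reduce the index set from `S'` to `sp`, then enlarge to `s`
    have h3 : ∑ p ∈ S', cbar p * ∑ j ∈ Finset.range (p.2 + 1), coef p j * m (p.1, j) =
        ∑ p ∈ sp, c p * (D p t - R p t) := by
      symm
      refine (Finset.sum_congr rfl fun p hp ↦ ?_).trans (Finset.sum_subset hsp_sub fun p hpS hpsp ↦ ?_)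
      · have hps : p ∈ s := (Finset.mem_filter.1 hp).1
        rw [hT' p, hcbar]; dsimp only; rw [if_pos hps]
      · rw [hcbar]; dsimp only
        by_cases hps : p ∈ s
        · exfalso
          exact hpsp (Finset.mem_filter.2 ⟨hps, hS'pos p hpS⟩)
        · rw [if_neg hps, zero_mul]
    have h4 : ∑ p ∈ sp, c p * (D p t - R p t) = ∑ p ∈ s, c p * (D p t - R p t) := by
      refine Finset.sum_subset (Finset.filter_subset _ _) fun p hps hpsp ↦ ?_
      have hre : p.1.re ≤ 0 := by
        by_contra h
        exact hpsp (Finset.mem_filter.2 ⟨hps, not_le.1 h⟩)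
      rw [← hT' p]
      simp [hcoef_nonpos p hre]
    rw [h1, Finset.sum_congr rfl fun p hp ↦ by rw [h2 p hp], h3, h4]
    simp only [mul_sub, Finset.sum_sub_distrib, hVE' t ht, hE']
  -- (2) the remainder is small: `t^θ ‖E'(t)‖ → 0`
  have hE'small : ∀ θ : ℝ, 0 < θ → Tendsto (fun t : ℝ ↦ t ^ θ * ‖E' t‖) (𝓝[>] (0 : ℝ)) (𝓝 0) := by
    intro θ hθ
    have hθt : Tendsto (fun t : ℝ ↦ t ^ θ) (𝓝[>] (0 : ℝ)) (𝓝 0) := by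
      have hct : ContinuousAt (fun u : ℝ ↦ u ^ θ) 0 := Real.continuousAt_rpow_const 0 θ (Or.inr hθ.le)
      have := hct.tendsto
      rw [Real.zero_rpow hθ.ne'] at this
      exact tendsto_nhdsWithin_of_tendsto_nhds this
    have hEt : Tendsto (fun t : ℝ ↦ t ^ θ * ‖E t‖) (𝓝[>] (0 : ℝ)) (𝓝 0) := by
      have hc0 : Tendsto (fun t : ℝ ↦ ‖E t‖) (𝓝[>] (0 : ℝ)) (𝓝 ‖E ((0 : ℝ) : ℂ)‖) :=
        tendsto_nhdsWithin_of_tendsto_nhds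
          ((hE.continuous.comp Complex.continuous_ofReal).norm.tendsto 0)
      have := hθt.mul hc0
      rwa [zero_mul] at this
    have hRt : Tendsto (fun t : ℝ ↦ ∑ p ∈ s, ‖c p‖ * (t ^ θ * ‖R p t‖)) (𝓝[>] (0 : ℝ)) (𝓝 0) := by
      have := tendsto_finsetSum s fun p _ ↦ (hR p θ hθ).const_mul ‖c p‖
      simpa using this
    have hsum := hEt.add hRt
    rw [add_zero] at hsum
    refine squeeze_zero_norm' ?_ hsum
    filter_upwards [self_mem_nhdsWithin] with t ht
    have ht' : 0 < t := ht
    have hθ0 : 0 ≤ t ^ θ := Real.rpow_nonneg ht'.le _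
    rw [Real.norm_eq_abs, abs_mul, abs_of_nonneg hθ0, abs_norm]
    calc t ^ θ * ‖E' t‖ ≤ t ^ θ * (‖E t‖ + ∑ p ∈ s, ‖c p‖ * ‖R p t‖) := by
          refine mul_le_mul_of_nonneg_left ?_ hθ0
          refine (norm_sub_le _ _).trans ?_
          gcongr
          refine (norm_sum_le _ _).trans (Finset.sum_le_sum fun p _ ↦ ?_)
          rw [norm_mul]
      _ = t ^ θ * ‖E t‖ + ∑ p ∈ s, ‖c p‖ * (t ^ θ * ‖R p t‖) := by
          rw [mul_add, Finset.mul_sum]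
          congr 1
          exact Finset.sum_congr rfl fun p _ ↦ by ring
  -- (3) elimination: all `c'` vanish
  have hzero := eq_zero_of_sum_log_pow_mul_cpow_eq S' hS'pos c' hE'small
    (by filter_upwards [self_mem_nhdsWithin] with t ht; exact hident t ht)
  -- (4) the coefficient of `pstar`: `c' pstar = c pstar · coef pstar k*`
  have hpstarS' : pstar ∈ S' := hsp_sub (Finset.mem_filter.2 ⟨hpstar, hpstar_re⟩)
  have hc'pstar : c' pstar = c pstar * coef pstar pstar.2 := by
    rw [hc']; dsimp only
    rw [Finset.sum_eq_single pstar.2]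
    · rw [Prod.mk.eta, hcbar]; dsimp only; rw [if_pos hpstar]
    · intro i _ hi
      rcases lt_or_gt_of_ne hi with hlt | hgt
      · -- `i < k*`: the coefficient `coef (w*, i) k*` vanishes
        rw [hcoef_gt (pstar.1, i) pstar.2 hlt, mul_zero]
      · -- `i > k*`: `(w*, i) ∉ s` by maximality
        have hnot : (pstar.1, i) ∉ s := fun h ↦ by
          have := hmax' _ h rfl
          exact absurd this (not_le.2 hgt)
        rw [hcbar]; dsimp only; rw [if_neg hnot, zero_mul]
    · intro h
      exact absurd (Finset.mem_range.2 (Nat.lt_succ_of_le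
        (Finset.le_sup (f := Prod.snd) hpstar))) h
  have h0 : c pstar * coef pstar pstar.2 = 0 := by rw [← hc'pstar]; exact hzero pstar hpstarS'
  exact (mul_eq_zero.1 h0).resolve_right (hcoef_top pstar hpstar_re)

/-! ## C. The `𝓕₊`-symmetry: indices with `Re w ≤ 0` are moved to `Re w ≥ 1` -/

/-- **"On est donc ramené au cas précédemment éliminé"** (TeX l.416–420): if
`Σ_{(w,k)∈s} c_{w,k}(f, X^λ_{w,k}] = 0` on `K_{λ,λ}` and all indices have `Re w < 1/2`, then
`Σ_{(w,k)∈s} (−1)^k c_{w,k} (g, X^λ_{1−w,k}] = 0` on `K_{λ,λ}` (apply the hypothesis to `f = 𝓕₊g` and use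
`(𝓕₊g, X^λ_{w,k}] = (−1)^k (g, X^λ_{1−w,k}]`, `xPairingR_fourier_swap`).
[cite: Burnol2001CRAS, Théorème 1.5, proof (TeX l.416–420)] -/
theorem pairings_eq_zero_swap {lam : ℝ} (hlam : 0 < lam) (s : Finset (ℂ × ℕ)) (c : ℂ × ℕ → ℂ)
    (hs : ∀ p ∈ s, p.1.re < 1 / 2)
    (hc : ∀ f : Lp ℂ 2 (volume : Measure ℝ), f ∈ soninSpace lam lam → ∀ G P : ℂ → ℂ,
      HasEntireMellin f G → IsXPairingFnC G P → ∑ p ∈ s, c p * xPairingR G P p.1 p.2 = 0) :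
    ∀ g : Lp ℂ 2 (volume : Measure ℝ), g ∈ soninSpace lam lam → ∀ G' P' : ℂ → ℂ,
      HasEntireMellin g G' → IsXPairingFnC G' P' →
      ∑ q ∈ s.image (fun p : ℂ × ℕ ↦ (1 - p.1, p.2)),
        ((-1) ^ q.2 * c (1 - q.1, q.2)) * xPairingR G' P' q.1 q.2 = 0 := by
  intro g hg G' P' hG' _
  obtain ⟨hFg, hFFg⟩ := fourier_mem_soninSpace_swap hg
  set f : Lp ℂ 2 (volume : Measure ℝ) := (𝓕 g : Lp ℂ 2 (volume : Measure ℝ)) with hf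
  obtain ⟨G, hG⟩ := Burnol2001CRAS_thm1_1_holds lam lam hlam hlam f hFg
  obtain ⟨P, hPd, hPeq⟩ := exists_compensated_pairing_fn hlam hFg hG
  have hP : IsXPairingFnC G P := ⟨hPd, hPeq⟩
  have hG'f : HasEntireMellin (𝓕 f : Lp ℂ 2 (volume : Measure ℝ)) G' := by rw [hf, hFFg]; exact hG'
  have h := hc f hFg G P hG hP
  have hinj : Set.InjOn (fun p : ℂ × ℕ ↦ (1 - p.1, p.2)) s := by
    intro p _ q _ hpq
    simp only [Prod.mk.injEq, sub_right_inj] at hpq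
    exact Prod.ext hpq.1 hpq.2
  rw [Finset.sum_image hinj, ← h]
  refine Finset.sum_congr rfl fun p hp ↦ ?_
  dsimp only
  rw [sub_sub_cancel, xPairingR_fourier_swap hlam hFg hG hP hG'f P' p.2 (hs p hp)]
  rw [Prod.mk.eta]
  ring

/-! ## D. The discharge -/

/-- One coefficient vanishes (if there are indices at all). [cite: Burnol2001CRAS, Théorème 1.5, proof (TeX l.409–420)] -/
private theorem exists_coeff_eq_zero {lam : ℝ} (hlam : 0 < lam) (s : Finset (ℂ × ℕ)) (c : ℂ × ℕ → ℂ)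
    (hc : ∀ f : Lp ℂ 2 (volume : Measure ℝ), f ∈ soninSpace lam lam → ∀ G P : ℂ → ℂ,
      HasEntireMellin f G → IsXPairingFnC G P → ∑ p ∈ s, c p * xPairingR G P p.1 p.2 = 0)
    (hne : s.Nonempty) : ∃ p ∈ s, c p = 0 := by
  classical
  by_cases hex : ∃ p ∈ s, 0 < p.1.re
  · exact exists_coeff_eq_zero_of_pos hlam s c hc hex
  · push Not at hex
    have hs : ∀ p ∈ s, p.1.re < 1 / 2 := fun p hp ↦ (hex p hp).trans_lt (by norm_num)
    have hc' := pairings_eq_zero_swap hlam s c hs hc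
    obtain ⟨p₀, hp₀⟩ := hne
    have hex' : ∃ q ∈ s.image (fun p : ℂ × ℕ ↦ (1 - p.1, p.2)), 0 < q.1.re := by
      refine ⟨(1 - p₀.1, p₀.2), Finset.mem_image.2 ⟨p₀, hp₀, rfl⟩, ?_⟩
      simp only [Complex.sub_re, Complex.one_re]
      linarith [hex p₀ hp₀]
    obtain ⟨q, hq, hcq⟩ := exists_coeff_eq_zero_of_pos hlam _ _ hc' hex'
    obtain ⟨p, hp, rfl⟩ := Finset.mem_image.1 hq
    refine ⟨p, hp, ?_⟩
    simp only [sub_sub_cancel, Prod.mk.eta, mul_eq_zero, pow_eq_zero_iff', neg_eq_zero, one_ne_zero,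
      ne_eq, false_and, false_or] at hcq
    exact hcq

/-- **Discharge of `Burnol2001CRAS_thm1_5C`** (Burnol 2001, Théorème 1.5, faithful form): for `λ > 0`
the functionals `f ↦ (f, X^λ_{w,k}]` on `K_{λ,λ}`, `(w,k) ∈ ℂ × ℕ`, are linearly independent — by
induction on the number of indices, removing one vanishing coefficient at a time
(`exists_coeff_eq_zero`). [cite: Burnol2001CRAS, Théorème 1.5 (TeX l.406–420)] -/
theorem Burnol2001CRAS_thm1_5C_holds : Burnol2001CRAS_thm1_5C := by
  intro lam hlam s
  induction s using Finset.strongInduction with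
  | H s ih =>
    intro c hc p hp
    obtain ⟨p₀, hp₀, hc₀⟩ := exists_coeff_eq_zero hlam s c hc ⟨p, hp⟩
    by_cases hpp : p = p₀
    · rw [hpp]; exact hc₀
    · refine ih (s.erase p₀) (Finset.erase_ssubset hp₀) c ?_ p (Finset.mem_erase.2 ⟨hpp, hp⟩)
      intro f hf G P hG hP
      have h := hc f hf G P hG hP
      rwa [← Finset.add_sum_erase s _ hp₀, hc₀, zero_mul, zero_add] at h

end Burnol2001

end Literature.Analysis.DeBrangesSpaces
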